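import Literature.Combinatorics.SimpleGraph.HarmonicMorphisms
import HarnessLib

/-!
# Harmonic morphisms III: composition (the category of graphs with harmonic morphisms),
# multiplicativity of multiplicities and degrees, functoriality of `φ_*`, `φ^*`, and the basic
# examples — maps to an edge, automorphisms, coverings (Baker–Norine 2009, §2.1 Remark 8, §3
# Examples 19–21, §4.1)

Source (held, read at the page; statements VERBATIM). M. Baker, S. Norine, *Harmonic morphisms
and hyperelliptic graphs*, Int. Math. Res. Not. IMRN 2009, no. 15, 2914–2955 [BakerNorine2009]
(held text `paper:arxiv-0707.1309`, chunks p0007, p0010, p0011).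

§2.1, **Remark 8.** «One can check directly from the definition that the composition of two
harmonic morphisms is again harmonic. Therefore the set of all graphs, together with the harmonic
morphisms between them, forms a category.» «We say that a harmonic morphism `φ : G → G′` is
non-degenerate if `m_φ(x) ≥ 1` for every `x ∈ V(G)`.»
§3, **Example 19 (Harmonic morphisms to trees).** «Every graph `G` admits a non-constant harmonic
morphism to a tree. More precisely, suppose `|V(G)| ≥ 2` and let `x ∈ V(G)` be a vertex of degree
`k ≥ 1`. Let `T` be the graph consisting of two vertices `a, b` connected by a single edge `e′`,
and let `φ` be the morphism sending `x` to `a` and every `y ∈ V(G) \ {x}` to `b` […]. Then `φ` is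
a harmonic morphism of degree `k`.» **Example 20 (Automorphisms).** «A graph automorphism
`α : G → G` is a non-degenerate harmonic morphism of degree `1`.» **Example 21 (Coverings).**
«A morphism `φ : G → G′` is a covering of degree `d ≥ 1` if `deg(x) = deg(φ(x))` for every
`x ∈ V(G)` and `φ⁻¹(e′)` consists of `d` disjoint edges for every edge `e′ ∈ E(G′)`. A covering
is a harmonic morphism; more precisely, a covering morphism is the same thing as a harmonic
morphism for which `m_φ(x) = 1` and `v_φ(x) = 0` for all `x ∈ V(G)`.»
§4.1. «It is straightforward to check that if `ψ : G → G′` and `φ : G′ → G″` are harmonic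
morphisms and `D ∈ Div(G), D″ ∈ Div(G″)`, then `φ ∘ ψ : G → G″` is harmonic, and we have
`(φ ∘ ψ)_*(D) = φ_*(ψ_*(D))` and `(φ ∘ ψ)^*(D″) = ψ^*(φ^*(D″))`.»

## What is formalised (simple graphs, the setting of `HarmonicMorphisms`; here the first map is
## `φ : G → G′` and the second `ψ : G′ → G″`)

* §1 **Remark 8 / §4.1**: `IsHarmonicMorphism.comp`; the multiplicities of a composite,
  `m_{ψ∘φ}(x) = m_φ(x) m_ψ(φ(x))` (`horizMult_comp`) and
  `v_{ψ∘φ}(x) = v_φ(x) + m_φ(x) v_ψ(φ(x))` (`vertMult_comp`, the count behind Remark 8);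
  `deg(ψ ∘ φ) = deg(φ) deg(ψ)` (`harmonicDegree_comp`); functoriality `(ψ∘φ)_* = ψ_* ∘ φ_*`
  (`divPushforward_comp`) and `(ψ∘φ)^* = φ^* ∘ ψ^*` (`divPullback_comp`);
* §2 **Example 19**: the map `u ↦ [u = x]` to the edge `K₂` (`⊤` on `Bool`) is harmonic with
  `m(x) = deg(x)`, of degree `deg(x)`, (non-constant when `|V(G)| ≥ 2`);
* §3 **Example 20**: a graph isomorphism (in particular an automorphism) is harmonic with
  `v ≡ 0`, `m(x) = 1` at every non-isolated `x`, of degree `1`;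
* §4 **Example 21** in the simple-graph reading: «harmonic with `m_φ ≡ 1`, `v_φ ≡ 0`» is
  equivalent to `φ` being a local isomorphism (adjacency-preserving and bijective from `N(x)`
  onto `N(φ(x))` for every `x`), and then `deg(x) = deg(φ(x))` and the edges over an edge are
  pairwise disjoint.

Theorems only; no `sorry`; no new definitions; no named facts.
-/

open Finset SimpleGraph Matrix

namespace Literature.Combinatorics.SimpleGraph.BakerNorine

variable {V V' V'' : Type*} [Fintype V] [Fintype V'] [Fintype V''] [DecidableEq V']
  [DecidableEq V'']
variable {G : SimpleGraph V} [DecidableRel G.Adj] {G' : SimpleGraph V'} [DecidableRel G'.Adj]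
  {G'' : SimpleGraph V''} [DecidableRel G''.Adj]

/-! ### §1 Composition of harmonic morphisms (Remark 8) and functoriality (§4.1) -/

section Comp

variable {φ : V → V'} {ψ : V' → V''} (hψ : IsHarmonicMorphism G' G'' ψ)
  (hφ : IsHarmonicMorphism G G' φ)
include hψ hφ

/-- The count behind Remark 8: over a neighbour `z` of `ψ(φ(x))`, the neighbours of `x` number
`m_φ(x) · m_ψ(φ(x))` (they lie over the `m_ψ(φ(x))` neighbours `y′` of `φ(x)` above `z`, `m_φ(x)`
over each). [cite: BakerNorine2009, §2.1 (Remark 8)] -/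
theorem IsHarmonicMorphism.card_filter_comp {x : V} {z : V''} (hz : G''.Adj (ψ (φ x)) z) :
    #{u ∈ G.neighborFinset x | ψ (φ u) = z} =
      horizMult G G' φ x * horizMult G' G'' ψ (φ x) := by
  -- sort the neighbours `u` of `x` over `z` by `y′ = φ(u)`, a neighbour of `φ(x)` over `z`
  have hmaps : ∀ u ∈ ({u ∈ G.neighborFinset x | ψ (φ u) = z} : Finset V),
      φ u ∈ ({y' ∈ G'.neighborFinset (φ x) | ψ y' = z} : Finset V') := by
    intro u hu
    rw [mem_filter, mem_neighborFinset] at hu ⊢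
    refine ⟨?_, hu.2⟩
    rcases hφ.adj_or_eq hu.1 with h | h
    · exact h
    · exfalso
      rw [← h] at hu
      exact G''.ne_of_adj hz hu.2
  rw [Finset.card_eq_sum_card_fiberwise hmaps]
  have hfib : ∀ y' ∈ ({y' ∈ G'.neighborFinset (φ x) | ψ y' = z} : Finset V'),
      #{u ∈ ({u ∈ G.neighborFinset x | ψ (φ u) = z} : Finset V) | φ u = y'} =
        horizMult G G' φ x := by
    intro y' hy'
    rw [mem_filter, mem_neighborFinset] at hy'
    rw [hφ.horizMult_eq hy'.1]
    congr 1
    ext u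
    simp only [mem_filter, mem_neighborFinset]
    constructor
    · rintro ⟨⟨hu, -⟩, huy⟩
      exact ⟨hu, huy⟩
    · rintro ⟨hu, huy⟩
      exact ⟨⟨hu, by rw [huy, hy'.2]⟩, huy⟩
  rw [Finset.sum_congr rfl hfib, Finset.sum_const, smul_eq_mul, mul_comm, hψ.horizMult_eq hz]

/-- **Remark 8**: «the composition of two harmonic morphisms is again harmonic» (so graphs with
harmonic morphisms form a category). [cite: BakerNorine2009, §2.1 (Remark 8); §4.1] -/
theorem IsHarmonicMorphism.comp : IsHarmonicMorphism G G'' (ψ ∘ φ) where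
  adj_or_eq := fun x u hxu => by
    simp only [Function.comp_apply]
    rcases hφ.adj_or_eq hxu with h | h
    · rcases hψ.adj_or_eq h with h' | h'
      · exact Or.inl h'
      · exact Or.inr h'
    · exact Or.inr (by rw [h])
  conformal := fun x z₁ z₂ h₁ h₂ => by
    simp only [Function.comp_apply] at h₁ h₂ ⊢
    rw [hψ.card_filter_comp hφ h₁, hψ.card_filter_comp hφ h₂]

/-- **Multiplicities multiply**: `m_{ψ∘φ}(x) = m_φ(x) · m_ψ(φ(x))`.
[cite: BakerNorine2009, §2.1 (Remark 8)] -/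
theorem IsHarmonicMorphism.horizMult_comp (x : V) :
    horizMult G G'' (ψ ∘ φ) x = horizMult G G' φ x * horizMult G' G'' ψ (φ x) := by
  by_cases hex : ∃ z, G''.Adj (ψ (φ x)) z
  · obtain ⟨z, hz⟩ := hex
    rw [(hψ.comp hφ).horizMult_eq (y := z) hz]
    exact hψ.card_filter_comp hφ hz
  · push Not at hex
    rw [horizMult_eq_zero_of_forall_not_adj (φ := ψ ∘ φ) hex,
      horizMult_eq_zero_of_forall_not_adj (φ := ψ) hex, mul_zero]

omit hψ in
omit [Fintype V''] in
/-- **Vertical multiplicities of a composite**: `v_{ψ∘φ}(x) = v_φ(x) + m_φ(x) · v_ψ(φ(x))`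
(a neighbour `u` of `x` with `ψ(φ(u)) = ψ(φ(x))` is either `φ`-vertical, or lies over one of the
`v_ψ(φ(x))` neighbours `y′` of `φ(x)` with `ψ(y′) = ψ(φ(x))`, `m_φ(x)` over each).
[cite: BakerNorine2009, §2.1 (Remark 8 and eq. (2.1))] -/
theorem IsHarmonicMorphism.vertMult_comp (ψ : V' → V'') (x : V) :
    vertMult G (ψ ∘ φ) x = vertMult G φ x + horizMult G G' φ x * vertMult G' ψ (φ x) := by
  rw [vertMult_apply, vertMult_apply, vertMult_apply]
  simp only [Function.comp_apply]
  -- split the neighbours over `ψ(φ(x))` into the `φ`-vertical and the `φ`-horizontal ones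
  rw [← Finset.card_filter_add_card_filter_not (fun u => φ u = φ x)]
  congr 1
  · congr 1
    ext u
    simp only [mem_filter, mem_neighborFinset]
    constructor
    · rintro ⟨⟨hu, -⟩, h⟩
      exact ⟨hu, h⟩
    · rintro ⟨hu, h⟩
      exact ⟨⟨hu, by rw [h]⟩, h⟩
  · -- the horizontal ones lie over the neighbours `y′ ∼ φ(x)` with `ψ(y′) = ψ(φ(x))`
    have hmaps : ∀ u ∈ ({u ∈ ({u ∈ G.neighborFinset x | ψ (φ u) = ψ (φ x)} : Finset V) |
        ¬ φ u = φ x} : Finset V),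
        φ u ∈ ({y' ∈ G'.neighborFinset (φ x) | ψ y' = ψ (φ x)} : Finset V') := by
      intro u hu
      simp only [mem_filter, mem_neighborFinset] at hu ⊢
      refine ⟨?_, hu.1.2⟩
      rcases hφ.adj_or_eq hu.1.1 with h | h
      · exact h
      · exact absurd h.symm hu.2
    rw [Finset.card_eq_sum_card_fiberwise hmaps]
    have hfib : ∀ y' ∈ ({y' ∈ G'.neighborFinset (φ x) | ψ y' = ψ (φ x)} : Finset V'),
        #{u ∈ ({u ∈ ({u ∈ G.neighborFinset x | ψ (φ u) = ψ (φ x)} : Finset V) | ¬ φ u = φ x} :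
          Finset V) | φ u = y'} = horizMult G G' φ x := by
      intro y' hy'
      rw [mem_filter, mem_neighborFinset] at hy'
      rw [hφ.horizMult_eq hy'.1]
      congr 1
      ext u
      simp only [mem_filter, mem_neighborFinset]
      constructor
      · rintro ⟨⟨⟨hu, -⟩, -⟩, huy⟩
        exact ⟨hu, huy⟩
      · rintro ⟨hu, huy⟩
        refine ⟨⟨⟨hu, by rw [huy, hy'.2]⟩, ?_⟩, huy⟩
        rw [huy]
        exact (G'.ne_of_adj hy'.1).symm
    rw [Finset.sum_congr rfl hfib, Finset.sum_const, smul_eq_mul, mul_comm]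

/-- **Degrees multiply**: `deg(ψ ∘ φ) = deg(φ) · deg(ψ)` (`G′` connected, the degree of `φ`
read at any `y₀`; the degrees of `ψ` and `ψ ∘ φ` read at the same `z`).
[cite: BakerNorine2009, §2.1 (Remark 8, Lemma 10)] -/
theorem IsHarmonicMorphism.harmonicDegree_comp (hG' : G'.Connected) (y₀ : V') (z : V'') :
    harmonicDegree G G'' (ψ ∘ φ) z = harmonicDegree G G' φ y₀ * harmonicDegree G' G'' ψ z := by
  rw [harmonicDegree_apply (ψ ∘ φ) z, harmonicDegree_apply ψ z, Finset.mul_sum]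
  -- sort the fibre of `z` under `ψ ∘ φ` by `y = φ(x)`
  have hmaps : ∀ x ∈ univ.filter (fun x => (ψ ∘ φ) x = z), φ x ∈ univ.filter (fun y => ψ y = z) :=
    fun x hx => mem_filter.2 ⟨mem_univ _, (mem_filter.1 hx).2⟩
  rw [← Finset.sum_fiberwise_of_maps_to hmaps]
  refine Finset.sum_congr rfl fun y hy => ?_
  have hyz : ψ y = z := (mem_filter.1 hy).2
  have hset : ({x ∈ univ.filter (fun x => (ψ ∘ φ) x = z) | φ x = y} : Finset V) =
      univ.filter (fun x => φ x = y) := by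
    ext x
    simp only [mem_filter, mem_univ, true_and, Function.comp_apply]
    exact ⟨fun h => h.2, fun h => ⟨by rw [h, hyz], h⟩⟩
  rw [hset, hφ.harmonicDegree_eq hG' y₀ y, harmonicDegree_apply φ y, Finset.sum_mul]
  refine Finset.sum_congr rfl fun x hx => ?_
  rw [hψ.horizMult_comp hφ, (mem_filter.1 hx).2]

omit hψ hφ in
omit [Fintype V''] [DecidableRel G.Adj] [DecidableRel G'.Adj] [DecidableRel G''.Adj] in
/-- **Functoriality of `φ_*`**: `(ψ ∘ φ)_*(D) = ψ_*(φ_*(D))` (the covariant «Albanese» functor).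
[cite: BakerNorine2009, §4.1] -/
theorem divPushforward_comp (φ : V → V') (ψ : V' → V'') (D : V → ℤ) :
    divPushforward (ψ ∘ φ) D = divPushforward ψ (divPushforward φ D) := by
  funext z
  rw [divPushforward_apply, divPushforward_apply]
  simp only [divPushforward_apply]
  have hmaps : ∀ x ∈ univ.filter (fun x => (ψ ∘ φ) x = z), φ x ∈ univ.filter (fun y => ψ y = z) :=
    fun x hx => mem_filter.2 ⟨mem_univ _, (mem_filter.1 hx).2⟩
  rw [← Finset.sum_fiberwise_of_maps_to hmaps]
  refine Finset.sum_congr rfl fun y hy => ?_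
  have hyz : ψ y = z := (mem_filter.1 hy).2
  congr 1
  ext x
  simp only [mem_filter, mem_univ, true_and, Function.comp_apply]
  exact ⟨fun h => h.2, fun h => ⟨by rw [h, hyz], h⟩⟩

/-- **Functoriality of `φ^*`**: `(ψ ∘ φ)^*(D″) = φ^*(ψ^*(D″))` (the contravariant «Picard»
functor). [cite: BakerNorine2009, §4.1] -/
theorem IsHarmonicMorphism.divPullback_comp (D'' : V'' → ℤ) :
    divPullback G G'' (ψ ∘ φ) D'' = divPullback G G' φ (divPullback G' G'' ψ D'') := by
  funext x
  rw [divPullback_apply, divPullback_apply, divPullback_apply, hψ.horizMult_comp hφ,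
    Function.comp_apply, Nat.cast_mul, mul_assoc]

end Comp

/-! ### §2 Example 19: harmonic morphisms to an edge -/

section Edge

variable [DecidableEq V] (G)

/-- **Example 19**: the map sending `x` to one end of the edge `K₂` and every other vertex to
the other end is a harmonic morphism. [cite: BakerNorine2009, Example 19] -/
theorem isHarmonicMorphism_top_bool (x : V) :
    IsHarmonicMorphism G (⊤ : SimpleGraph Bool) (fun u => decide (u = x)) where
  adj_or_eq := fun u w huw => by
    by_cases hu : u = x
    · subst hu
      left
      rw [top_adj]
      have hw : w ≠ u := (G.ne_of_adj huw).symm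
      simp [hw]
    · by_cases hw : w = x
      · subst hw
        left
        rw [top_adj]
        simp [hu]
      · right
        simp [hu, hw]
  conformal := fun u y₁ y₂ h₁ h₂ => by
    rw [top_adj] at h₁ h₂
    have : y₁ = y₂ := by
      revert h₁ h₂
      cases y₁ <;> cases y₂ <;> cases decide (u = x) <;> simp
    rw [this]

/-- **Example 19**: `m(x) = deg(x)` for the map to `K₂`.
[cite: BakerNorine2009, Example 19] -/
theorem horizMult_top_bool_self (x : V) :
    horizMult G (⊤ : SimpleGraph Bool) (fun u => decide (u = x)) x = G.degree x := by
  rw [(isHarmonicMorphism_top_bool G x).horizMult_eq (y := false)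
    (by rw [top_adj]; simp), ← card_neighborFinset_eq_degree]
  congr 1
  ext u
  simp only [mem_filter, mem_neighborFinset, decide_eq_false_iff_not, and_iff_left_iff_imp]
  exact fun h => (G.ne_of_adj h).symm

/-- **Example 19**: at `u ≠ x`, `m(u) = 1` or `0` according as `u ∼ x` or not.
[cite: BakerNorine2009, Example 19] -/
theorem horizMult_top_bool_of_ne {x u : V} (hu : u ≠ x) :
    horizMult G (⊤ : SimpleGraph Bool) (fun w => decide (w = x)) u =
      if G.Adj u x then 1 else 0 := by
  rw [(isHarmonicMorphism_top_bool G x).horizMult_eq (y := true)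
    (by rw [top_adj]; simp [hu])]
  have hset : ({w ∈ G.neighborFinset u | decide (w = x) = true} : Finset V) =
      if G.Adj u x then {x} else ∅ := by
    ext w
    simp only [mem_filter, mem_neighborFinset, decide_eq_true_eq]
    split_ifs with h
    · simp only [mem_singleton]
      exact ⟨fun hw => hw.2, fun hw => ⟨hw ▸ h, hw⟩⟩
    · simp only [Finset.notMem_empty, iff_false, not_and]
      rintro hw rfl
      exact h hw
  rw [hset]
  split_ifs <;> simp

/-- **Example 19**: «`φ` is a harmonic morphism of degree `k`», `k = deg(x)` (the degree read at
the image of `x`). [cite: BakerNorine2009, Example 19] -/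
theorem harmonicDegree_top_bool (x : V) :
    harmonicDegree G (⊤ : SimpleGraph Bool) (fun u => decide (u = x)) true = G.degree x := by
  rw [harmonicDegree_apply]
  have hset : univ.filter (fun u : V => decide (u = x) = true) = {x} := by
    ext u
    simp
  rw [hset, Finset.sum_singleton, horizMult_top_bool_self]

end Edge

/-! ### §3 Example 20: automorphisms and isomorphisms -/

section Iso

variable (γ : G ≃g G')

omit [Fintype V'] [DecidableRel G'.Adj] in
/-- **Example 20**: a graph isomorphism (in particular an automorphism) is a harmonic morphism.
[cite: BakerNorine2009, Example 20] -/
theorem isHarmonicMorphism_iso : IsHarmonicMorphism G G' γ where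
  adj_or_eq := fun _ _ h => Or.inl (γ.map_adj_iff.2 h)
  conformal := fun x y₁ y₂ h₁ h₂ => by
    have key : ∀ y, G'.Adj (γ x) y → #{u ∈ G.neighborFinset x | γ u = y} = 1 := fun y hy => by
      rw [Finset.card_eq_one]
      refine ⟨γ.symm y, ?_⟩
      ext u
      simp only [mem_filter, mem_neighborFinset, mem_singleton]
      constructor
      · rintro ⟨-, rfl⟩
        exact (γ.symm_apply_apply u).symm
      · rintro rfl
        refine ⟨?_, γ.apply_symm_apply y⟩
        have := γ.symm.map_adj_iff.2 hy
        rwa [RelIso.symm_apply_apply] at this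
    rw [key y₁ h₁, key y₂ h₂]

omit [Fintype V'] [DecidableRel G'.Adj] in
/-- **Example 20**: an isomorphism has no vertical edges, `v ≡ 0`.
[cite: BakerNorine2009, Example 20 (with Example 21)] -/
theorem vertMult_iso (x : V) : vertMult G γ x = 0 := by
  rw [vertMult_apply, Finset.card_eq_zero, Finset.filter_eq_empty_iff]
  intro u hu h
  rw [mem_neighborFinset] at hu
  exact G.ne_of_adj hu (γ.injective h).symm

/-- **Example 20**: an isomorphism is non-degenerate, `m(x) = 1` at every non-isolated `x`.
[cite: BakerNorine2009, Example 20] -/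
theorem horizMult_iso {x : V} (hx : 0 < G.degree x) : horizMult G G' γ x = 1 := by
  obtain ⟨u, hu⟩ := (G.degree_pos_iff_exists_adj x).1 hx
  rw [(isHarmonicMorphism_iso γ).horizMult_eq (y := γ u) (γ.map_adj_iff.2 hu),
    Finset.card_eq_one]
  refine ⟨u, ?_⟩
  ext w
  simp only [mem_filter, mem_neighborFinset, mem_singleton]
  constructor
  · rintro ⟨-, h⟩
    exact γ.injective h
  · rintro rfl
    exact ⟨hu, rfl⟩

/-- **Example 20**: an isomorphism «is a non-degenerate harmonic morphism of degree `1`» (read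
at the image of a non-isolated vertex). [cite: BakerNorine2009, Example 20] -/
theorem harmonicDegree_iso {x : V} (hx : 0 < G.degree x) :
    harmonicDegree G G' γ (γ x) = 1 := by
  rw [harmonicDegree_apply]
  have hset : univ.filter (fun u => γ u = γ x) = {x} := by
    ext u
    simp only [mem_filter, mem_univ, true_and, mem_singleton]
    exact γ.injective.eq_iff
  rw [hset, Finset.sum_singleton, horizMult_iso γ hx]

end Iso

/-! ### §4 Example 21: coverings -/

section Covering

variable {φ : V → V'}

/-- **Example 21** (simple-graph reading): a harmonic morphism with `m_φ ≡ 1` and `v_φ ≡ 0` is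
a local isomorphism — adjacency-preserving and bijective from `N(x)` onto `N(φ(x))` for every
`x`. [cite: BakerNorine2009, Example 21] -/
theorem IsHarmonicMorphism.bijOn_neighborSet (hφ : IsHarmonicMorphism G G' φ)
    (hv : ∀ x, vertMult G φ x = 0) (hm : ∀ x y, G'.Adj (φ x) y → horizMult G G' φ x = 1) :
    (∀ ⦃x u : V⦄, G.Adj x u → G'.Adj (φ x) (φ u)) ∧
      ∀ x, Set.BijOn φ (G.neighborSet x) (G'.neighborSet (φ x)) := by
  have hadj : ∀ ⦃x u : V⦄, G.Adj x u → G'.Adj (φ x) (φ u) := fun x u hxu => by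
    rcases hφ.adj_or_eq hxu with h | h
    · exact h
    · exfalso
      have h0 := hv x
      rw [vertMult_apply, Finset.card_eq_zero, Finset.filter_eq_empty_iff] at h0
      exact h0 ((mem_neighborFinset _ _ _).2 hxu) h.symm
  refine ⟨hadj, fun x => ⟨fun u hu => hadj hu, ?_, ?_⟩⟩
  · intro u₁ hu₁ u₂ hu₂ heq
    rw [mem_neighborSet] at hu₁ hu₂
    have h1 := hm x (φ u₁) (hadj hu₁)
    rw [hφ.horizMult_eq (hadj hu₁)] at h1
    obtain ⟨w, hw⟩ := Finset.card_eq_one.1 h1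
    have hw1 : u₁ ∈ ({u ∈ G.neighborFinset x | φ u = φ u₁} : Finset V) :=
      mem_filter.2 ⟨(mem_neighborFinset _ _ _).2 hu₁, rfl⟩
    have hw2 : u₂ ∈ ({u ∈ G.neighborFinset x | φ u = φ u₁} : Finset V) :=
      mem_filter.2 ⟨(mem_neighborFinset _ _ _).2 hu₂, heq.symm⟩
    rw [hw, mem_singleton] at hw1 hw2
    rw [hw1, hw2]
  · intro y hy
    rw [mem_neighborSet] at hy
    have h1 := hm x y hy
    rw [hφ.horizMult_eq hy] at h1
    obtain ⟨w, hw⟩ := Finset.card_eq_one.1 h1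
    have hw' : w ∈ ({u ∈ G.neighborFinset x | φ u = y} : Finset V) := by
      rw [hw]
      exact mem_singleton_self w
    rw [mem_filter, mem_neighborFinset] at hw'
    exact ⟨w, hw'.1, hw'.2⟩

/-- **Example 21** (converse): a local isomorphism is a harmonic morphism with `m_φ ≡ 1`
(wherever defined) and `v_φ ≡ 0` — «a covering is a harmonic morphism».
[cite: BakerNorine2009, Example 21] -/
theorem isHarmonicMorphism_of_bijOn_neighborSet (hadj : ∀ ⦃x u : V⦄, G.Adj x u → G'.Adj (φ x) (φ u))
    (hbij : ∀ x, Set.BijOn φ (G.neighborSet x) (G'.neighborSet (φ x))) :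
    IsHarmonicMorphism G G' φ ∧ (∀ x, vertMult G φ x = 0) ∧
      ∀ x y, G'.Adj (φ x) y → horizMult G G' φ x = 1 := by
  -- over each neighbour `y` of `φ(x)` there is exactly one neighbour of `x`
  have hone : ∀ x y, G'.Adj (φ x) y → #{u ∈ G.neighborFinset x | φ u = y} = 1 := by
    intro x y hy
    obtain ⟨u, hu, rfl⟩ := (hbij x).2.2 ((mem_neighborSet _ _ _).2 hy)
    rw [Finset.card_eq_one]
    refine ⟨u, ?_⟩
    ext w
    simp only [mem_filter, mem_neighborFinset, mem_singleton]
    constructor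
    · rintro ⟨hw, heq⟩
      exact (hbij x).2.1 ((mem_neighborSet _ _ _).2 hw) hu heq
    · rintro rfl
      exact ⟨(mem_neighborSet _ _ _).1 hu, rfl⟩
  have hφ : IsHarmonicMorphism G G' φ :=
    { adj_or_eq := fun x u h => Or.inl (hadj h)
      conformal := fun x y₁ y₂ h₁ h₂ => by rw [hone x y₁ h₁, hone x y₂ h₂] }
  refine ⟨hφ, fun x => ?_, fun x y hy => by rw [hφ.horizMult_eq hy, hone x y hy]⟩
  rw [vertMult_apply, Finset.card_eq_zero, Finset.filter_eq_empty_iff]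
  intro u hu h
  rw [mem_neighborFinset] at hu
  exact G'.ne_of_adj (hadj hu) h.symm

/-- **Example 21**: a covering has `deg(x) = deg(φ(x))` for every `x`.
[cite: BakerNorine2009, Example 21] -/
theorem IsHarmonicMorphism.degree_eq_of_covering (hφ : IsHarmonicMorphism G G' φ)
    (hv : ∀ x, vertMult G φ x = 0) (hm : ∀ x y, G'.Adj (φ x) y → horizMult G G' φ x = 1)
    (x : V) : G.degree x = G'.degree (φ x) := by
  rw [hφ.degree_eq x, hv x, add_zero]
  by_cases h : ∃ y, G'.Adj (φ x) y
  · obtain ⟨y, hy⟩ := h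
    rw [hm x y hy, mul_one]
  · push Not at h
    rw [horizMult_eq_zero_of_forall_not_adj h, mul_zero, eq_comm, ← card_neighborFinset_eq_degree,
      Finset.card_eq_zero, Finset.eq_empty_iff_forall_notMem]
    exact fun y hy => h y ((mem_neighborFinset _ _ _).1 hy)

/-- **Example 21**: over an edge `y′z′` of `G′`, the edges `xu` of a covering (`φ(x) = y′`,
`φ(u) = z′`) are pairwise disjoint — each `x` over `y′` has exactly one neighbour over `z′`
(«`φ⁻¹(e′)` consists of `d` disjoint edges»). [cite: BakerNorine2009, Example 21] -/
theorem IsHarmonicMorphism.card_filter_le_one_of_covering (hφ : IsHarmonicMorphism G G' φ)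
    (hm : ∀ x y, G'.Adj (φ x) y → horizMult G G' φ x = 1) {x : V} {z' : V'}
    (hz' : G'.Adj (φ x) z') : #{u ∈ G.neighborFinset x | φ u = z'} = 1 := by
  rw [← hφ.horizMult_eq hz', hm x z' hz']

end Covering

end Literature.Combinatorics.SimpleGraph.BakerNorine
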